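import Summits.Ventures.WeilGRH.YoshidaGramEntryBoundsPrelim
import Summits.RiemannHypothesis.RiemannHypothesis.Theorems.WeilFormatCEntryArch
import HarnessLib

/-!
# The archimedean cross term of two modulated flat windows (weil-3 gen13)

Third ingredient of the general-centre Beurling–Selberg window law (after `WeilSelbergCrossIncrement`,
`WeilSelbergCrossPole`).  The cross increment of the pair `u_c`, `u_{c+Nπ/a}` is
`D_t = (−1)^N (sin(c′t) − sin(ct))/(Nπ)` on `[0, 2a]` (`c′ = c + Nπ/a`), so the archimedean part of
`W_a(u_c, u_{c′})` is `((−1)^N/(Nπ)) · ∫_{(0,2a]} ρ(t)(sin c′t − sin ct) dt`, `ρ(t) = e^{t/2}/(2 sinh t)`.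
Here that integral is EVALUATED at every real frequency and BOUNDED with decay in the height:

* `integral_exp_neg_mul_sin_eq` (`l² + ω² ≠ 0`, any `T`):
  `∫_0^T e^{−lt} sin(ωt) dt = (ω(1 − e^{−lT}cos ωT) − l e^{−lT} sin ωT)/(l² + ω²)` (the tree's
  `integral_exp_neg_mul_sin` is the lattice case `ωT ∈ 2πℤ`);
* **`setIntegral_weilArchDensity_mul_sin_eq`** (`a > 0`, any `ω`):
  `∫_{(0,2a]} ρ(t) sin(ωt) dt = ½ Im ψ(¼ + iω/2) − Σ_k e^{−2a l_k}(ω cos 2aω + l_k sin 2aω)/(l_k² + ω²)`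
  (`l_k = 2k + ½`; term-wise integration of the node series);
* `abs_archCrossRem_le`: the window remainder is `≤ (3/(2|ω|))·E(a)`, `E(a) = e^{−a}/(1 − e^{−4a})`;
* **`abs_setIntegral_weilArchDensity_mul_sin_sub_le`** (`2 ≤ ω ≤ ω′`):
  `|∫_{(0,2a]} ρ(t)(sin ω′t − sin ωt) dt| ≤ 2(ω′ − ω)/ω + 3E(a)/ω`;
* **`abs_selberg_archCross_le`**: for `c ≥ 2`, `N ≥ 1`, `c′ = c + Nπ/a`:
  `(1/π)|∫_{(0,2a]} ρ(t)(sin c′t − sin ct) dt| ≤ 2N/(ac) + 3E(a)/(πc)` — the same shape as the lattice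
  constant `N·2/(aω) + 2E/(πω)` of `WeilSelbergWindowLaw`.

No definitions, no named facts; RH-free.
-/

set_option autoImplicit false

noncomputable section

open Complex Set MeasureTheory
open scoped Real Topology

namespace Summit.Ventures.WeilGRH

open Literature.NumberTheory.LFunctions Literature.Analysis.SpecialFunctions
open Summit.RiemannHypothesis.RiemannHypothesis.Theorems.WeilFormatC

variable {a : ℝ}

/-! ## The node integral at a general frequency -/

/-- The quotient `(E(cos θ + i sin θ) − 1)/(−l + iω)` in Cartesian form (`l² + ω² ≠ 0`). -/
theorem cexp_polar_sub_one_div_eq (E co si : ℝ) {l ω : ℝ} (hs : l ^ 2 + ω ^ 2 ≠ 0) :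
    ((E : ℂ) * ((co : ℂ) + (si : ℂ) * I) - 1) / (-(l : ℂ) + ω * I) =
      (((l * (1 - E * co) + ω * (E * si)) / (l ^ 2 + ω ^ 2) : ℝ) : ℂ) +
        (((ω * (1 - E * co) - l * (E * si)) / (l ^ 2 + ω ^ 2) : ℝ) : ℂ) * I := by
  have hs' := neg_add_mul_I_ne_zero hs
  rw [div_eq_iff hs']
  apply Complex.ext
  · simp only [Complex.sub_re, Complex.ofReal_re, Complex.one_re, Complex.mul_re, Complex.add_re,
      Complex.ofReal_im, Complex.mul_im, Complex.I_re, Complex.I_im, Complex.add_im, Complex.neg_re,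
      Complex.neg_im]
    field_simp
    ring
  · simp only [Complex.sub_im, Complex.ofReal_im, Complex.one_im, Complex.mul_im, Complex.add_re,
      Complex.ofReal_re, Complex.mul_re, Complex.I_re, Complex.I_im, Complex.add_im, Complex.neg_re,
      Complex.neg_im]
    field_simp
    ring

/-- **`∫_0^T e^{−lt} sin(ωt) dt = (ω(1 − e^{−lT} cos ωT) − l e^{−lT} sin ωT)/(l² + ω²)`** (`l² + ω² ≠ 0`). -/
theorem integral_exp_neg_mul_sin_eq {l ω : ℝ} (hs : l ^ 2 + ω ^ 2 ≠ 0) (T : ℝ) :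
    ∫ t in (0 : ℝ)..T, Real.exp (-(l * t)) * Real.sin (ω * t) =
      (ω * (1 - Real.exp (-(l * T)) * Real.cos (ω * T)) - l * (Real.exp (-(l * T)) * Real.sin (ω * T))) /
        (l ^ 2 + ω ^ 2) := by
  have hs' := neg_add_mul_I_ne_zero hs
  have hint : IntervalIntegrable (fun t : ℝ ↦ cexp ((-(l : ℂ) + ω * I) * t)) volume 0 T := by
    apply Continuous.intervalIntegrable; fun_prop
  have him : ∀ t : ℝ, Real.exp (-(l * t)) * Real.sin (ω * t) = (cexp ((-(l : ℂ) + ω * I) * t)).im := by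
    intro t
    rw [cexp_neg_add_mul_I_mul]
    simp only [Complex.mul_re, Complex.add_re, Complex.ofReal_re, Complex.ofReal_im, Complex.mul_im,
      Complex.I_re, Complex.I_im, Complex.add_im]
    ring
  simp_rw [him]
  rw [show (∫ t in (0 : ℝ)..T, (cexp ((-(l : ℂ) + ω * I) * t)).im) =
      Complex.imCLM (∫ t in (0 : ℝ)..T, cexp ((-(l : ℂ) + ω * I) * t)) by
    rw [← Complex.imCLM.intervalIntegral_comp_comm hint]; rfl,
    integral_cexp_mul_zero T hs', cexp_neg_add_mul_I_mul l ω T, cexp_polar_sub_one_div_eq _ _ _ hs]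
  simp only [Complex.imCLM_apply, Complex.add_im, Complex.ofReal_im, Complex.mul_im, Complex.I_re, Complex.I_im,
    Complex.ofReal_re, mul_zero, zero_mul, zero_add, mul_one, add_zero]

/-! ## The archimedean sine integral at a general frequency -/

/-- The window remainder coefficient is bounded: `|(ω cos θ + l_k sin θ)/(l_k² + ω²)| ≤ 4|ω| + 2`. -/
theorem abs_archCrossRem_coeff_le (ω θ : ℝ) (k : ℕ) :
    |(ω * Real.cos θ + digammaNode k * Real.sin θ) / (digammaNode k ^ 2 + ω ^ 2)| ≤ |ω| * 4 + 2 := by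
  have hl := one_half_le_digammaNode k
  have hl0 := digammaNode_pos k
  have hpos : 0 < digammaNode k ^ 2 + ω ^ 2 := by positivity
  rw [abs_div, abs_of_pos hpos, div_le_iff₀ hpos]
  have h1 : |ω * Real.cos θ + digammaNode k * Real.sin θ| ≤ |ω| + digammaNode k := by
    have hc := Real.abs_cos_le_one θ
    have hsn := Real.abs_sin_le_one θ
    calc |ω * Real.cos θ + digammaNode k * Real.sin θ| ≤ |ω * Real.cos θ| + |digammaNode k * Real.sin θ| :=
          abs_add_le _ _
      _ = |ω| * |Real.cos θ| + digammaNode k * |Real.sin θ| := by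
          rw [abs_mul, abs_mul, abs_of_pos hl0]
      _ ≤ |ω| * 1 + digammaNode k * 1 := by gcongr
      _ = |ω| + digammaNode k := by ring
  have h2 : 1 / 4 ≤ digammaNode k ^ 2 + ω ^ 2 := by nlinarith [sq_nonneg ω]
  have h3 : digammaNode k ≤ 2 * (digammaNode k ^ 2 + ω ^ 2) := by nlinarith [sq_nonneg ω]
  nlinarith [abs_nonneg ω]

/-- The window remainder series converges (`a > 0`). -/
theorem summable_archCrossRem (ha : 0 < a) (ω : ℝ) :
    Summable (fun k : ℕ ↦ Real.exp (-(2 * a * digammaNode k)) *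
      ((ω * Real.cos (ω * (2 * a)) + digammaNode k * Real.sin (ω * (2 * a))) / (digammaNode k ^ 2 + ω ^ 2))) :=
  summable_exp_neg_mul_of_bounded ha (abs_archCrossRem_coeff_le ω (ω * (2 * a)))

/-- **`∫_{(0,2a]} ρ(t) sin(ωt) dt = ½ Im ψ(¼ + iω/2) − Σ_k e^{−2a l_k}(ω cos 2aω + l_k sin 2aω)/(l_k² + ω²)`**
for EVERY real `ω` (`a > 0`; `l_k = 2k + ½`).  At the lattice frequencies `ω = πm/a` this is the tree's
`setIntegral_weilArchDensity_mul_sin`. -/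
theorem setIntegral_weilArchDensity_mul_sin_eq (ha : 0 < a) (ω : ℝ) :
    ∫ t in Ioc 0 (2 * a), weilArchDensity t * Real.sin (ω * t) =
      (Complex.digamma (1 / 4 + (ω : ℂ) / 2 * I)).im / 2 -
        ∑' k : ℕ, Real.exp (-(2 * a * digammaNode k)) *
          ((ω * Real.cos (ω * (2 * a)) + digammaNode k * Real.sin (ω * (2 * a))) / (digammaNode k ^ 2 + ω ^ 2)) := by
  have hT : (0 : ℝ) < 2 * a := by positivity
  have h1 := hasSum_setIntegral_exp_mul hT (K := fun t ↦ Real.sin (ω * t)) (C := |ω|)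
    (by fun_prop) (fun t ht ↦ abs_sin_mul_le ht.1.le)
  have hterm : ∀ k : ℕ, ∫ t in Ioc 0 (2 * a), Real.exp (-(digammaNode k * t)) * Real.sin (ω * t) =
      ω / (digammaNode k ^ 2 + ω ^ 2) - Real.exp (-(2 * a * digammaNode k)) *
        ((ω * Real.cos (ω * (2 * a)) + digammaNode k * Real.sin (ω * (2 * a))) / (digammaNode k ^ 2 + ω ^ 2)) := by
    intro k
    have hs : digammaNode k ^ 2 + ω ^ 2 ≠ 0 := by have := digammaNode_pos k; positivity
    rw [← intervalIntegral.integral_of_le hT.le, integral_exp_neg_mul_sin_eq hs,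
      show digammaNode k * (2 * a) = 2 * a * digammaNode k by ring]
    field_simp
    ring
  simp_rw [hterm] at h1
  have h2 : HasSum (fun k : ℕ ↦ ω / (digammaNode k ^ 2 + ω ^ 2))
      ((Complex.digamma (1 / 4 + (ω : ℂ) / 2 * I)).im / 2) := by
    have h := (hasSum_im_digamma_quarter ω).div_const 2
    refine h.congr_fun fun k ↦ ?_
    ring
  exact h1.unique (h2.sub (summable_archCrossRem ha ω).hasSum)

/-- **The window remainder decays in the height**: for `ω ≠ 0`,
`|Σ_k e^{−2a l_k}(ω cos 2aω + l_k sin 2aω)/(l_k² + ω²)| ≤ (3/(2|ω|)) · e^{−a}/(1 − e^{−4a})`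
(`|ω|/(l² + ω²) ≤ 1/|ω|`, `l/(l² + ω²) ≤ 1/(2|ω|)`). -/
theorem abs_archCrossRem_le (ha : 0 < a) {ω : ℝ} (hω : ω ≠ 0) :
    |∑' k : ℕ, Real.exp (-(2 * a * digammaNode k)) *
        ((ω * Real.cos (ω * (2 * a)) + digammaNode k * Real.sin (ω * (2 * a))) / (digammaNode k ^ 2 + ω ^ 2))| ≤
      3 / (2 * |ω|) * (Real.exp (-a) / (1 - Real.exp (-(4 * a)))) := by
  have hsum := summable_archCrossRem ha ω
  have hE := summable_exp_neg_two_mul_digammaNode ha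
  have hω0 : 0 < |ω| := abs_pos.2 hω
  have hterm : ∀ k : ℕ, |Real.exp (-(2 * a * digammaNode k)) *
      ((ω * Real.cos (ω * (2 * a)) + digammaNode k * Real.sin (ω * (2 * a))) / (digammaNode k ^ 2 + ω ^ 2))| ≤
      Real.exp (-(2 * a * digammaNode k)) * (3 / (2 * |ω|)) := by
    intro k
    have hl0 := digammaNode_pos k
    have hpos : 0 < digammaNode k ^ 2 + ω ^ 2 := by positivity
    rw [abs_mul, abs_of_pos (Real.exp_pos _)]
    refine mul_le_mul_of_nonneg_left ?_ (Real.exp_pos _).le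
    rw [abs_div, abs_of_pos hpos, div_le_iff₀ hpos]
    have h1 : |ω * Real.cos (ω * (2 * a)) + digammaNode k * Real.sin (ω * (2 * a))| ≤ |ω| + digammaNode k := by
      have hc := Real.abs_cos_le_one (ω * (2 * a))
      have hsn := Real.abs_sin_le_one (ω * (2 * a))
      calc |ω * Real.cos (ω * (2 * a)) + digammaNode k * Real.sin (ω * (2 * a))|
          ≤ |ω * Real.cos (ω * (2 * a))| + |digammaNode k * Real.sin (ω * (2 * a))| := abs_add_le _ _
        _ = |ω| * |Real.cos (ω * (2 * a))| + digammaNode k * |Real.sin (ω * (2 * a))| := by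
            rw [abs_mul, abs_mul, abs_of_pos hl0]
        _ ≤ |ω| * 1 + digammaNode k * 1 := by gcongr
        _ = |ω| + digammaNode k := by ring
    have hω2 : ω ^ 2 = |ω| ^ 2 := (sq_abs ω).symm
    -- `(|ω| + l)·2|ω| ≤ 3(l² + ω²)`: `2ω² ≤ 2(l² + ω²)` and `2l|ω| ≤ l² + ω²`
    have h2 : (|ω| + digammaNode k) * (2 * |ω|) ≤ 3 * (digammaNode k ^ 2 + ω ^ 2) := by
      rw [hω2]; nlinarith [sq_nonneg (digammaNode k - |ω|), sq_nonneg (digammaNode k)]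
    calc |ω * Real.cos (ω * (2 * a)) + digammaNode k * Real.sin (ω * (2 * a))|
        ≤ |ω| + digammaNode k := h1
      _ = (|ω| + digammaNode k) * (2 * |ω|) / (2 * |ω|) := by field_simp
      _ ≤ 3 * (digammaNode k ^ 2 + ω ^ 2) / (2 * |ω|) := by gcongr
      _ = 3 / (2 * |ω|) * (digammaNode k ^ 2 + ω ^ 2) := by ring
  calc |∑' k : ℕ, Real.exp (-(2 * a * digammaNode k)) *
        ((ω * Real.cos (ω * (2 * a)) + digammaNode k * Real.sin (ω * (2 * a))) / (digammaNode k ^ 2 + ω ^ 2))|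
      ≤ ∑' k : ℕ, |Real.exp (-(2 * a * digammaNode k)) *
        ((ω * Real.cos (ω * (2 * a)) + digammaNode k * Real.sin (ω * (2 * a))) / (digammaNode k ^ 2 + ω ^ 2))| := by
        have := norm_tsum_le_tsum_norm hsum.norm
        simpa only [Real.norm_eq_abs] using this
    _ ≤ ∑' k : ℕ, Real.exp (-(2 * a * digammaNode k)) * (3 / (2 * |ω|)) :=
        Summable.tsum_le_tsum hterm hsum.abs (hE.mul_right _)
    _ = 3 / (2 * |ω|) * (Real.exp (-a) / (1 - Real.exp (-(4 * a)))) := by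
        rw [tsum_mul_right, tsum_exp_neg_two_mul_digammaNode ha]; ring

/-! ## The cross archimedean integral and its height decay -/

/-- **THE ARCHIMEDEAN CROSS INTEGRAL DECAYS IN THE HEIGHT** (`a > 0`, `2 ≤ ω ≤ ω′`):
`|∫_{(0,2a]} ρ(t)(sin ω′t − sin ωt) dt| ≤ 2(ω′ − ω)/ω + 3E(a)/ω`, `E(a) = e^{−a}/(1 − e^{−4a})`
(`½|Im ψ(¼+iω′/2) − Im ψ(¼+iω/2)| ≤ 2(ω′−ω)/ω` by `abs_im_digamma_quarter_sub_le`, and the two window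
remainders by `abs_archCrossRem_le`). -/
theorem abs_setIntegral_weilArchDensity_mul_sin_sub_le (ha : 0 < a) {ω ω' : ℝ} (hω : 2 ≤ ω) (hωω' : ω ≤ ω') :
    |∫ t in Ioc 0 (2 * a), weilArchDensity t * (Real.sin (ω' * t) - Real.sin (ω * t))| ≤
      2 * (ω' - ω) / ω + 3 * (Real.exp (-a) / (1 - Real.exp (-(4 * a)))) / ω := by
  have hT : (0 : ℝ) < 2 * a := by positivity
  have hω0 : 0 < ω := by linarith
  have hω0' : 0 < ω' := by linarith
  have hi : IntegrableOn (fun t ↦ weilArchDensity t * Real.sin (ω * t)) (Ioc 0 (2 * a)) :=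
    integrableOn_weilArchDensity_mul hT (K := fun t ↦ Real.sin (ω * t)) (C := |ω|) (by fun_prop)
      (fun t ht ↦ abs_sin_mul_le ht.1.le)
  have hi' : IntegrableOn (fun t ↦ weilArchDensity t * Real.sin (ω' * t)) (Ioc 0 (2 * a)) :=
    integrableOn_weilArchDensity_mul hT (K := fun t ↦ Real.sin (ω' * t)) (C := |ω'|) (by fun_prop)
      (fun t ht ↦ abs_sin_mul_le ht.1.le)
  have hsplit : ∫ t in Ioc 0 (2 * a), weilArchDensity t * (Real.sin (ω' * t) - Real.sin (ω * t)) =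
      (∫ t in Ioc 0 (2 * a), weilArchDensity t * Real.sin (ω' * t)) -
        ∫ t in Ioc 0 (2 * a), weilArchDensity t * Real.sin (ω * t) := by
    rw [← integral_sub hi' hi]
    exact setIntegral_congr_fun measurableSet_Ioc fun t _ ↦ by ring
  rw [hsplit, setIntegral_weilArchDensity_mul_sin_eq ha ω', setIntegral_weilArchDensity_mul_sin_eq ha ω]
  set E := Real.exp (-a) / (1 - Real.exp (-(4 * a))) with hEdef
  set R := ∑' k : ℕ, Real.exp (-(2 * a * digammaNode k)) *
      ((ω * Real.cos (ω * (2 * a)) + digammaNode k * Real.sin (ω * (2 * a))) / (digammaNode k ^ 2 + ω ^ 2)) with hR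
  set R' := ∑' k : ℕ, Real.exp (-(2 * a * digammaNode k)) *
      ((ω' * Real.cos (ω' * (2 * a)) + digammaNode k * Real.sin (ω' * (2 * a))) / (digammaNode k ^ 2 + ω' ^ 2))
    with hR'
  have hRle : |R| ≤ 3 / (2 * |ω|) * E := abs_archCrossRem_le ha hω0.ne'
  have hRle' : |R'| ≤ 3 / (2 * |ω'|) * E := abs_archCrossRem_le ha hω0'.ne'
  rw [abs_of_pos hω0] at hRle
  rw [abs_of_pos hω0'] at hRle'
  have hE0 : 0 ≤ E := by
    rw [hEdef]
    exact div_nonneg (Real.exp_pos _).le (by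
      have := Real.exp_lt_one_iff.2 (show -(4 * a) < 0 by linarith); linarith)
  have hψ := abs_im_digamma_quarter_sub_le (ω := ω) (ω' := ω') (by rw [abs_of_pos hω0]; exact hω)
    (by positivity) (by rw [abs_of_pos hω0, abs_of_pos hω0']; exact hωω')
  rw [abs_of_pos hω0, abs_of_nonneg (by linarith : (0 : ℝ) ≤ ω' - ω)] at hψ
  -- `3/(2ω′) ≤ 3/(2ω)`
  have hcmp : 3 / (2 * ω') * E ≤ 3 / (2 * ω) * E := by
    apply mul_le_mul_of_nonneg_right _ hE0
    exact div_le_div_of_nonneg_left (by norm_num : (0 : ℝ) ≤ 3) (by positivity : (0 : ℝ) < 2 * ω)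
      (by linarith : 2 * ω ≤ 2 * ω')
  have hgoal : |(Complex.digamma (1 / 4 + (ω' : ℂ) / 2 * I)).im / 2 - R' -
      ((Complex.digamma (1 / 4 + (ω : ℂ) / 2 * I)).im / 2 - R)| ≤
      |(Complex.digamma (1 / 4 + (ω' : ℂ) / 2 * I)).im - (Complex.digamma (1 / 4 + (ω : ℂ) / 2 * I)).im| / 2 +
        |R'| + |R| := by
    rw [show (Complex.digamma (1 / 4 + (ω' : ℂ) / 2 * I)).im / 2 - R' -
        ((Complex.digamma (1 / 4 + (ω : ℂ) / 2 * I)).im / 2 - R) =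
        ((Complex.digamma (1 / 4 + (ω' : ℂ) / 2 * I)).im - (Complex.digamma (1 / 4 + (ω : ℂ) / 2 * I)).im) / 2 +
          (-R') + R by ring]
    have e1 := abs_add_le
      (((Complex.digamma (1 / 4 + (ω' : ℂ) / 2 * I)).im - (Complex.digamma (1 / 4 + (ω : ℂ) / 2 * I)).im) / 2 +
        -R') R
    have e2 := abs_add_le
      (((Complex.digamma (1 / 4 + (ω' : ℂ) / 2 * I)).im - (Complex.digamma (1 / 4 + (ω : ℂ) / 2 * I)).im) / 2) (-R')
    rw [abs_neg, abs_div, abs_two] at e2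
    linarith
  refine hgoal.trans ?_
  have h3 : |(Complex.digamma (1 / 4 + (ω' : ℂ) / 2 * I)).im - (Complex.digamma (1 / 4 + (ω : ℂ) / 2 * I)).im| / 2 ≤
      2 * (ω' - ω) / ω := by
    rw [div_le_iff₀ (by norm_num : (0 : ℝ) < 2)]
    calc _ ≤ 4 * (ω' - ω) / ω := hψ
      _ = 2 * (ω' - ω) / ω * 2 := by ring
  have h4 : |R'| + |R| ≤ 3 * E / ω := by
    calc |R'| + |R| ≤ 3 / (2 * ω) * E + 3 / (2 * ω) * E := add_le_add (hRle'.trans hcmp) hRle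
      _ = 3 * E / ω := by field_simp; ring
  linarith

/-- **THE BEURLING–SELBERG ARCHIMEDEAN CROSS CONSTANT** (`a > 0`, `c ≥ 2`, `N ≥ 1`, `c′ = c + Nπ/a`):
`(1/π) |∫_{(0,2a]} ρ(t)(sin c′t − sin ct) dt| ≤ 2N/(ac) + 3E(a)/(πc)` — the archimedean cross weight of
the general-centre window law, of the same shape as the lattice constant `2N/(aω) + 2E/(πω)`. -/
theorem abs_selberg_archCross_le (ha : 0 < a) {c : ℝ} (hc : 2 ≤ c) {N : ℕ} (hN : 1 ≤ N) :
    1 / π * |∫ t in Ioc 0 (2 * a), weilArchDensity t * (Real.sin ((c + N * π / a) * t) - Real.sin (c * t))| ≤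
      2 * N / (a * c) + 3 * (Real.exp (-a) / (1 - Real.exp (-(4 * a)))) / (π * c) := by
  have hc0 : 0 < c := by linarith
  have hN' : (1 : ℝ) ≤ N := by exact_mod_cast hN
  have hle : c ≤ c + N * π / a := by
    have : 0 ≤ (N : ℝ) * π / a := by positivity
    linarith
  have h := abs_setIntegral_weilArchDensity_mul_sin_sub_le ha hc hle
  rw [show c + N * π / a - c = N * π / a by ring] at h
  have hπ := Real.pi_pos
  calc 1 / π * |∫ t in Ioc 0 (2 * a), weilArchDensity t * (Real.sin ((c + N * π / a) * t) - Real.sin (c * t))|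
      ≤ 1 / π * (2 * (N * π / a) / c + 3 * (Real.exp (-a) / (1 - Real.exp (-(4 * a)))) / c) :=
        mul_le_mul_of_nonneg_left h (by positivity)
    _ = 2 * N / (a * c) + 3 * (Real.exp (-a) / (1 - Real.exp (-(4 * a)))) / (π * c) := by
        field_simp

end Summit.Ventures.WeilGRH

end
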